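import Summits.Ventures.HSemireg.MethodInstanceG6ThetaSecant
import Summits.HodgeConjecture.HodgeConjecture.Theorems.Ring2HabitatWeilComponentsRefereedFourfolds
import Literature.AlgebraicGeometry.Deligne1982.WeilClassesSquaresIsogenyClass
import HarnessLib

/-!
# Venture HSemireg — the g = 6 THETA-SECANT method instance read CELL BY CELL for abelian fourfolds: every component
# `(2, ℚ(√-d), δ)`, and the Weil FIELD (not `d`) is what matters (`63 = 3²·7`, `99 = 3²·11`)

HONEST FRAMING. Lean index of the computation cell `pub-hsemireg` (seat p8). Corollaries of
`MethodInstanceG6ThetaSecant.lean` (the VERDICT-G6 v1.0 V-4 METHOD INSTANCE on the split sixfold component) read in the Hodge summit's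
CELL currency `WeilClassesComponent 2 d δ` (every member of the fourfold component with invariants `(2, ℚ(√-d), δ)`, `δ ∈ ℚˣ/Nm Kˣ` —
NON-SPLIT cells included) and re-indexed by the Weil FIELD: the theta-secant rows `m = 8, 10` have `ψ₀² = -63, -99`, i.e.
`K = ℚ(√-7), ℚ(√-11)`, and `WeilAlgebraicAll 2 (N²·d) ⟹ WeilAlgebraicAll 2 d` (`weilAlgebraicAll_of_sq_mul`: the Weil plane of `(A, φ)`
lies in that of `(A, N·φ)`). Under the SAME hypotheses as there — BY NAME `weilFamilyReach_hyperbolic` (refereed) and `PerfectComplexRankTransfer C`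
(the venture's ASSUMPTION; F-1: kernel-linked to nothing), BY VALUE the theta-secant row with its certificate «rank 48 = bound 48» — the
cells `(2, ℚ(√-d), δ)` for `d ∈ {3, 15, 35, 7, 11}` and EVERY `δ` follow; for `d ∈ {7, 11, 15, 35}` and `δ` non-split these are cells of
the Hodge summit's HYPOTHESIS `WeilFourfoldResidualSq` (in print only as the PREPRINT [Markman2025SecantWeil] Cor. 1.6.1). Nothing here
says HC, HC_CM or HC_AV is proved; nothing is asserted about any explicit variety; theorems only (0 `def`, 0 `sorry`, no named fact).
The LEVEL-`N` form of the row is seat p11's `ladder_of_reach_of_perfectComplexRankTransfer_of_complex` (`AmplificationChainG2n.lean`);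
at `N = 3` it is file 1's `weilSixfoldsSplit_and_fourfoldsAll_of_reach_of_perfectComplexRankTransfer_of_complex`, binder for binder.
References: [vanGeemen1994HodgeAV] 4.9, Lemma 5.2; [MoonenZarhin1998WeilClasses] §1; [Schoen1998HodgeWeilAddendum] §10;
[Markman2025SecantWeil] Cor. 1.6.1 (preprint); [BuchweitzFlenner2008HH] Prop. 6.4.4; [Deligne1982HodgeCycles] proof of Thm. 4.8.
-/

noncomputable section

open CategoryTheory AlgebraicGeometry
open Literature.AlgebraicGeometry.Motives Literature.AlgebraicGeometry.HodgeTheory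
open Literature.AlgebraicGeometry.Deligne1982
open Literature.AlgebraicGeometry.KTheory
open Literature.AlgebraicTopology.SingularHomology
open Literature.AlgebraicGeometry.VanGeemen1994

namespace Summit.Ventures.HSemireg

open Summit.HodgeConjecture.HodgeConjecture
open Summit.HodgeConjecture.HodgeConjecture.WeilTypeLadder
open Summit.HodgeConjecture.HodgeConjecture.Cruxes.HodgeAbelianVarieties.EStepSecantInduction
open Summit.HodgeConjecture.HodgeConjecture.Ring2.Hypotheses
open Summit.HodgeConjecture.HodgeConjecture.Ring2.Habitat
open Summit.Ventures.HSemireg.GeneralStructure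

/-! ## §1 The Weil plane depends only on `K`: descending a square factor of `d` -/

/-- **`WeilAlgebraicAll n (N²·d) ⟹ WeilAlgebraicAll n d`** (any `N`; `N = 0` is degenerate but harmless): for `(A, φ)` with
`φ ≫ φ = -d` the pair `(A, N·φ)` has `(N·φ)² = -(N²d)` and the Weil plane of `(A, φ, d)` lies in that of `(A, N·φ, N²d)` (tree:
`weilClassesOf_le_weilClassesOf_nsmul`), so the
hypothesis at `N²d` applies to every rational `(n,n)` class of the former. (Converse direction of the tree's `weilAlgebraicAll_sq_mul`, which
needs an isogeny; this direction is elementary.) [cite: vanGeemen1994HodgeAV, 4.9 and Lemma 5.2 (5)] [cite: MoonenZarhin1998WeilClasses, §1] -/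
theorem weilAlgebraicAll_of_sq_mul {n N d : ℕ} (h : WeilAlgebraicAll n (N ^ 2 * d)) : WeilAlgebraicAll n d := by
  intro A φ hA hφ c hc hrat hhodge
  have hφ' : (N • φ) ≫ (N • φ) = -((N ^ 2 * d) • 𝟙 A) := by
    rw [Preadditive.nsmul_comp, Preadditive.comp_nsmul, hφ]
    simp only [smul_neg, smul_smul]
    congr 2
    ring
  exact h A (N • φ) hA hφ' c (weilClassesOf_le_weilClassesOf_nsmul A φ n d N hc) hrat hhodge

/-! ## §2 The theta-secant row read cell by cell (fourfolds), and by field -/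

section Cells

variable {C : ChernCharacterBetti}

/-- **Every fourfold CELL `(2, ℚ(√-d), δ)` from ONE hyperbolic rank-class seed at level `3`** — split AND non-split `δ`: reach ∧
`PerfectComplexRankTransfer C` ∧ `HasHyperbolicSeedOn (rankObjClass C) 3 d` ⟹ `WeilClassesComponent 2 d δ` for every `δ ∈ ℚˣ/Nm Kˣ`
(the census's row currency). [cite: vanGeemen1994HodgeAV, Lemma 5.2 (3)] [cite: Schoen1998HodgeWeilAddendum, §10]
[cite: Markman2025SecantWeil, Cor. 1.6.1 (preprint)] [cite: Deligne1982HodgeCycles, proof of Thm. 4.8] -/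
theorem weilClassesComponent_two_of_reach_of_perfectComplexRankTransfer_of_hyperbolicSeedOn_three
    (hF : weilFamilyReach_hyperbolic) (hT : PerfectComplexRankTransfer C) {d : ℕ} (hd : 0 < d)
    (hS : HasHyperbolicSeedOn (rankObjClass C) 3 d) (δ : weilNormResidueGroup d) : WeilClassesComponent 2 d δ :=
  weilClassesComponent_two_of_weilAlgebraicAll
    (weilAlgebraicAll_two_of_reach_of_perfectComplexRankTransfer_of_hyperbolicSeedOn_three hF hT hd hS) δ

/-- **… and for the field: a seed at level `3` for `ψ₀² = -(N²·d)` gives every `ℚ(√-d)` fourfold** (`WeilAlgebraicAll 2 d`) and every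
cell `(2, ℚ(√-d), δ)`. For the theta-secant rows: `m = 8` (`ψ₀² = -63 = -(3²·7)`) ⟹ all `ℚ(√-7)`-Weil fourfolds; `m = 10`
(`-99 = -(3²·11)`) ⟹ all `ℚ(√-11)`-Weil fourfolds — under the hypotheses BY NAME / BY VALUE of `MethodInstanceG6ThetaSecant.lean`.
[cite: vanGeemen1994HodgeAV, 4.9 and Lemma 5.2] [cite: Markman2025SecantWeil, Cor. 1.6.1 (preprint)]
[cite: Deligne1982HodgeCycles, proof of Thm. 4.8] -/
theorem weilAlgebraicAll_two_of_reach_of_perfectComplexRankTransfer_of_hyperbolicSeedOn_three_sq_mul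
    (hF : weilFamilyReach_hyperbolic) (hT : PerfectComplexRankTransfer C) {N d : ℕ} (hN : 0 < N) (hd : 0 < d)
    (hS : HasHyperbolicSeedOn (rankObjClass C) 3 (N ^ 2 * d)) :
    WeilAlgebraicAll 2 d ∧ ∀ δ : weilNormResidueGroup d, WeilClassesComponent 2 d δ := by
  have hNd : 0 < N ^ 2 * d := Nat.mul_pos (pow_pos hN 2) hd
  have h : WeilAlgebraicAll 2 d := weilAlgebraicAll_of_sq_mul
    (weilAlgebraicAll_two_of_reach_of_perfectComplexRankTransfer_of_hyperbolicSeedOn_three hF hT hNd hS)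
  exact ⟨h, weilClassesComponent_two_of_weilAlgebraicAll h⟩

/-- **The theta-secant certificate row, CELL reading** — the numeral form of `MethodInstanceG6ThetaSecant.lean` §3
(`…_of_certificate`: the split CM sixfold anchor with `ψ₀² = -(N²·d)`, the Weil datum, the object `E` with its source `G`, the ONE numeral
`r₀` on both sides — `hr : r(P, ch E) = r₀`, `h2 : dim Ext²(G,G) ≤ r₀`, theta-secant `r₀ = 48` — `hext`, `hneg`, `h0`) ⟹ under
`weilFamilyReach_hyperbolic` and `PerfectComplexRankTransfer C`: the split `ℚ(√-(N²d))` sixfolds, ALL `ℚ(√-d)`-Weil FOURFOLDS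
(`WeilAlgebraicAll 2 d`) and EVERY fourfold cell `(2, ℚ(√-d), δ)`. Rows of record: `(N, d) = (1,3), (1,15), (1,35), (3,7), (3,11)` for
`m = 2, 4, 6, 8, 10`. The cells with `d ∈ {7, 11, 15, 35}` and `δ` non-split are cells of the Hodge summit's hypothesis `WeilFourfoldResidualSq`
(in print only as a preprint); here they are CONDITIONAL on the named hypotheses — nothing is discharged.
[cite: Markman2025SecantWeil, Cor. 1.6.1 (preprint)] [cite: BuchweitzFlenner2008HH, Prop. 6.4.4] [cite: vanGeemen1994HodgeAV, Lemma 5.2]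
[cite: Deligne1982HodgeCycles, proof of Thm. 4.8] -/
theorem weilCells_of_reach_of_perfectComplexRankTransfer_of_thetaSecantCertificate
    (hF : weilFamilyReach_hyperbolic) (hT : PerfectComplexRankTransfer C) {N d : ℕ} (hN : 0 < N) (hd : 0 < d)
    (P : AbelianVariety ℂ) (ψ₀ : P ⟶ P) (e : ProjectiveEmbedding P.X) (a : complexBetti (projectiveSpace e.n ℂ) 2)
    (hP : P.dim = 2 * 3) (hψ : ψ₀ ≫ ψ₀ = -((N ^ 2 * d) • 𝟙 P)) (ha : IsRationalClass a) (ha0 : a ≠ 0)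
    (hhyp : IsHyperbolicWeilType P ψ₀ 3 (symmetrisedClass (N ^ 2 * d) P ψ₀ e a))
    (w : complexBetti P.X (2 * 3)) (hwW : w ∈ weilClassesOf P ψ₀ 3 (N ^ 2 * d)) (hwr : IsRationalClass w) (hw0 : w ≠ 0)
    (I : Finset ℕ) (hI : ∀ p : ℕ, 1 ≤ p → p ≤ 2 * 3 → p ∈ I) (E : CochainComplex P.X.left.Modules ℤ) (hE : IsBoundedVBComplex E)
    (q : ℚ) (c : ℕ → ℚ)
    (hch3 : chPerfect C P.X E hE.isFiniteLocallyFree 3 = ((q : ℚ) : ℂ) • cupPowTwo (symmetrisedClass (N ^ 2 * d) P ψ₀ e a) 3 + w)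
    (hchp : ∀ p ∈ I, p ≠ 3 →
      chPerfect C P.X E hE.isFiniteLocallyFree p = ((c p : ℚ) : ℂ) • cupPowTwo (symmetrisedClass (N ^ 2 * d) P ψ₀ e a) p)
    (r₀ : ℕ) (hr : contractionRank P (fun p ↦ chPerfect C P.X E hE.isFiniteLocallyFree p) = r₀)
    {Y₀ : SchemeOver ℂ} (G : CochainComplex Y₀.left.Modules ℤ)
    (hext : ∀ n : ℤ, n ≤ 2 → extRank P.X E n = extRank Y₀ G n)
    (hneg : ∀ k : ℤ, k < 0 → extRank Y₀ G k = 0) (h0 : extRank Y₀ G 0 = 1) (h2 : extRank Y₀ G 2 ≤ r₀) :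
    Stubs.WeilAlgebraicSplitHyperplane 3 (N ^ 2 * d) ∧ WeilAlgebraicAll 2 d ∧ ∀ δ : weilNormResidueGroup d, WeilClassesComponent 2 d δ := by
  have hNd : 0 < N ^ 2 * d := Nat.mul_pos (pow_pos hN 2) hd
  obtain ⟨hsix, hfour⟩ := weilSixfoldsSplit_and_fourfoldsAll_of_reach_of_perfectComplexRankTransfer_of_certificate hF hT hNd P ψ₀ e a
    hP hψ ha ha0 hhyp w hwW hwr hw0 I hI E hE q c hch3 hchp r₀ hr G hext hneg h0 h2
  have h : WeilAlgebraicAll 2 d := weilAlgebraicAll_of_sq_mul hfour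
  exact ⟨hsix, h, weilClassesComponent_two_of_weilAlgebraicAll h⟩

end Cells

/-! ## Audit: nothing is decided here
KERNEL: §1 (square descent of `WeilAlgebraicAll`, elementary), §2 (compositions with `MethodInstanceG6ThetaSecant.lean` and the Hodge summit's
`weilClassesComponent_two_of_weilAlgebraicAll`). BY NAME: `weilFamilyReach_hyperbolic`, `PerfectComplexRankTransfer C`. BY VALUE: the
theta-secant row. Not here: any non-split SIXFOLD cell (VERDICT-G6: «NO-in-families-tried», candidates 0); HC_CM; `σ ∘ ob = ⌟ch`. -/

end Summit.Ventures.HSemireg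

end
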